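import Literature.NumberTheory.EllipticCurves.HeightFamily
import Literature.NumberTheory.EllipticCurves.GaloisAction
import HarnessLib

/-!
# Duke 1997: almost all elliptic curves over `ℚ`, counted by height, have no exceptional prime

Source (primary, read in the publisher-typeset text): W. Duke, *Elliptic curves with no exceptional
primes*, C. R. Acad. Sci. Paris Sér. I Math. **325** (1997), no. 8, 813–818, note presented by
J.-P. Serre, "Note remise et acceptée le 5 septembre 1997" [Duke1997]; author's copy of the printed
note: `https://www.math.ucla.edu/~wdduke/preprints/elliptic1.pdf`. Restated verbatim (as used by the
later literature) in N. Jones, *Almost all elliptic curves are Serre curves*, Trans. Amer. Math. Soc.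
**362** (2010), 1547–1570 = arXiv:math/0611096, eq. (2)–(3) [Jones2010].

**Setting (pp. 813–815, quoted).** "Let `E` be an elliptic curve over `ℚ`. A prime `N` is said to be
*exceptional* for `E` if the mod `N` Galois representation of `E` is not surjective, i.e. if the Galois
group of the `N`-th division field of `E` is not equal to `GL(2, N)`" (Abstract, p. 813); "Say that `N`
is exceptional for `E` if `φ_N` is not surjective" (p. 814) — the negation of the tree's
`WeierstrassCurve.HasSurjectiveModNGaloisRep` (`GaloisAction.lean`: `ρ̄_{E,N} : Γ_ℚ → Aut(E[N])`
surjective; `Aut(E[N]) ≅ GL₂(ℤ/Nℤ)` for an elliptic curve in characteristic `0`). "The curve `E` has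
a unique model of the form (1) `y² = x³ + rx + s` with integral `r` and `s` such that `gcd(r³, s²)`
is twelfth-power free. The 'naive' height of `E` will be defined by `H(E) = max(|r|³, |s|²)`"
(p. 814) — "twelfth-power free" is exactly "no prime `q` with `q⁴ ∣ r` and `q⁶ ∣ s`", i.e. the
tree's `IsInHeightFamily (r, s)` (`HeightFamily.lean`), and `H` is `dukeHeight` below (the tree's
Bhargava–Shankar `naiveHeight (r, s) = max(4|r|³, 27 s²)` is a different normalisation of the same
box shape). "Let `𝒞(X)` be the set of all (isomorphism classes of) curves `E` with `H(E) ≤ X⁶`. As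
shown in [2] [Brumer, Invent. Math. 109 (1992)], (2) `|𝒞(X)| = C₁ X⁵ + O(X³)` with `C₁ = 4/ζ(10)`.
Let `ℰ(X)` be the set of curves in `𝒞(X)` with at least one exceptional prime." (p. 815).

**Theorem 1 (p. 815, verbatim; French summary p. 813 "Théorème 1. – `lim_{X→∞} |ℰ(X)|/|𝒞(X)| = 0`").**
"`lim_{X→∞} |ℰ(X)| / |𝒞(X)| = 0.` In fact, we will prove that for some absolute constant `B`,
`|ℰ(X)| ≪ X⁴ log^B X` but, since the Siegel–Walfisz theorem is used, the implied constant in `≪` is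
non-effective." (p. 814, French summary: "De façon plus précise, on montre que
`|ℰ(X)|/|𝒞(X)| ≪ X⁻¹ log^B X`"; p. 818: "we conclude that for some absolute `B > 0`,
`|ℰ(X)| ≪ X⁴ log^B X`, but where the implied constant is non-effective. Theorem 1 follows.")

Also printed there and NOT vendored here: "If `E` has CM then every odd `N` is exceptional" (p. 814);
"the number of CM curves in `ℰ(X)` is `2X³ + O(X²)`", "the number of curves in `ℰ(X)` with rational
2-torsion is `C₂X³ + O(X²)`", "`|ℰ(X)| ≫ X³`", and the conjecture `|ℰ(X)| ∼ CX³` (p. 815). Proof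
architecture (pp. 816–818): Theorem 2 — a mean-square estimate over `𝒞(X)` of the remainder in the
Chebotarev asymptotic `π_E(X; N, d, t) ∼ δ π(X; N, d)`, from the large sieve in two dimensions
(Gallagher, Huxley) with Deuring's and Hurwitz's class-number counts; Lemma 4 (Serre 1972, p. 284): a
subgroup of `GL(2, N)`, `N > 3`, containing an element of every prescribed `(tr, det)`, `det ≠ 0`, is
all of `GL(2, N)`; Lemma 5: `|ℰ_N(X)| ≪ X⁶ π(X; N, d)⁻²`; the Masser–Wüstholz bound
`N ≪ log^A H(E)` for an exceptional `N`; Siegel–Walfisz in the range `N ≪ log^A X`; `N = 2, 3`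
counted directly (`|ℰ₂(X)| = C₂X³ + O(X² log⁵ X)`, `C₂ = 3.93471…`; `|ℰ₃(X)| ≪ X³ log⁵ X`).

## What is vendored

ONE named fact, `Duke1997_exceptionalPrimes_densityZero`: Theorem 1 in the sequence form
`X : ℕ → ∞` (a special case of the printed real-variable limit — every real `X ≥ 1` box is squeezed
between two integer boxes, but only the integer-indexed statement is recorded), on Duke's own box
`H(E) ≤ X⁶ ⟺ |r| ≤ X² ∧ |s| ≤ X³` (`mem_dukeFamily_iff`), with the family (`IsInHeightFamily`,
`shortWeierstrass`) and the surjectivity predicate (`HasSurjectiveModNGaloisRep`) taken from the tree;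
everything else in this file is a definition with proved API.

Use: cell `pub-bsdpct`, `PERCENT-FULL.md` §(ii).2 (F1) / §5 — the density-one input
"`ρ̄_{E,p}` surjective for every prime `p`" (binder `hDuke`) of the typed THEOREM_{S_go} ("the full
BSD formula at every good ordinary `p ≥ 5` for a proportion `≥ c_rank` of curves"). The transfer to
the tree's normalisation `HeightDensityGE (fun AB ↦ ∀ p, ¬ IsExceptionalPrime (E_AB) p) 1`
(`naiveHeight < Y`) is the box nesting proved below — `dukeFamily X ⊆ heightFamilyBelow Y` for
`27·X⁶ < Y` and `heightFamilyBelow Y ⊆ dukeFamily X` for `Y ≤ X⁶` — together with the boundedness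
of `|𝒞(X')| / |𝒞(X)|` for `X'/X` bounded, an elementary count (or Brumer's (2)) left to the user.
-/

namespace Literature.NumberTheory.EllipticCurves

open scoped Classical
open Filter Topology WeierstrassCurve

/-! ### Definitions (Duke 1997, pp. 813–815) -/

/-- Duke's naive height of the model `y² = x³ + rx + s`: `H(E) = max(|r|³, |s|²)` (Duke 1997,
p. 814, the display after (1)); compare the tree's Bhargava–Shankar `naiveHeight (r, s) =
max(4|r|³, 27 s²)`. [cite: Duke1997, p. 814] -/
def dukeHeight (AB : ℤ × ℤ) : ℤ :=
  max (|AB.1| ^ 3) (AB.2 ^ 2)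

/-- `N` is an *exceptional prime* of the Weierstrass curve `W/ℚ`: `N` is a prime and the mod-`N`
Galois representation `ρ̄_{W,N} : Γ_ℚ → Aut(W[N]) (≅ GL₂(ℤ/Nℤ))` is not surjective (Duke 1997,
Abstract p. 813 and p. 814: "Say that `N` is exceptional for `E` if `φ_N` is not surjective").
[cite: Duke1997, p. 814] -/
def IsExceptionalPrime (W : WeierstrassCurve ℚ) (N : ℕ) : Prop :=
  N.Prime ∧ ¬ W.HasSurjectiveModNGaloisRep N

/-- Duke's `𝒞(X)`: the isomorphism classes of elliptic curves over `ℚ` with `H(E) ≤ X⁶`, realised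
as the pairs `(r, s)` of the height family — `4r³ + 27s² ≠ 0` and no prime `q` with `q⁴ ∣ r`,
`q⁶ ∣ s` (Duke's "gcd(r³, s²) twelfth-power free", the unique such model of each curve) — with
`max(|r|³, s²) ≤ X⁶`. It is filtered from the box `|r| ≤ X², |s| ≤ X³`, which loses nothing
(`mem_dukeFamily_iff`). (Duke 1997, p. 814 (1) and p. 815.) [cite: Duke1997, p. 815] -/
noncomputable def dukeFamily (X : ℕ) : Finset (ℤ × ℤ) :=
  (Finset.Icc (-((X : ℤ) ^ 2)) ((X : ℤ) ^ 2) ×ˢ Finset.Icc (-((X : ℤ) ^ 3)) ((X : ℤ) ^ 3)).filter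
    fun AB ↦ IsInHeightFamily AB ∧ dukeHeight AB ≤ (X : ℤ) ^ 6

/-- Duke's `ℰ(X)`: the curves of `𝒞(X)` with at least one exceptional prime (Duke 1997, p. 815:
"Let `ℰ(X)` be the set of curves in `𝒞(X)` with at least one exceptional prime").
[cite: Duke1997, p. 815] -/
noncomputable def dukeExceptionalFamily (X : ℕ) : Finset (ℤ × ℤ) :=
  (dukeFamily X).filter fun AB ↦ ∃ N : ℕ, IsExceptionalPrime (shortWeierstrass AB) N

/-! ### The theorem -/

/-- **Duke 1997, Theorem 1** (C. R. Acad. Sci. Paris Sér. I **325** (1997), p. 815; publisher text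
read at the author's copy; restated verbatim in Jones, Trans. AMS 362 (2010), eq. (2)). With `𝒞(X)`
the set of (isomorphism classes of) elliptic curves `E/ℚ` — in their unique model `y² = x³ + rx + s`,
`r, s ∈ ℤ`, `gcd(r³, s²)` twelfth-power free — of naive height `H(E) = max(|r|³, |s|²) ≤ X⁶`, and
`ℰ(X) ⊆ 𝒞(X)` the subset of curves having at least one exceptional prime (a prime `N` at which the
mod-`N` Galois representation is not surjective onto `GL(2, N)`):
"`lim_{X → ∞} |ℰ(X)| / |𝒞(X)| = 0`." Recorded along `X : ℕ → ∞` (a special case of the printed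
real-variable limit). The paper proves more precisely `|ℰ(X)| ≪ X⁴ log^B X` for an absolute `B`,
with a non-effective implied constant (Siegel–Walfisz), against `|𝒞(X)| = (4/ζ(10)) X⁵ + O(X³)`
(Brumer 1992). [cite: Duke1997, Thm. 1 (p. 815)] [cite: Jones2010, eq. (2)–(3) (restatement)] -/
def Duke1997_exceptionalPrimes_densityZero : Prop :=
  Tendsto (fun X : ℕ ↦ ((dukeExceptionalFamily X).card : ℝ) / (dukeFamily X).card) atTop (𝓝 0)

/-! ### API: the box is redundant, `ℰ(X) ⊆ 𝒞(X)`, and the nesting with the tree's height boxes -/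

/-- `H(r, s) ≤ X⁶` iff `|r| ≤ X²` and `|s| ≤ X³` (integers; cubes and squares are monotone on
the nonnegatives) (Duke 1997, p. 817: the box `ℬ = {|r| ≤ X², |s| ≤ X³}`). [cite: Duke1997, p. 817] -/
theorem dukeHeight_le_iff (AB : ℤ × ℤ) (X : ℕ) :
    dukeHeight AB ≤ (X : ℤ) ^ 6 ↔ |AB.1| ≤ (X : ℤ) ^ 2 ∧ |AB.2| ≤ (X : ℤ) ^ 3 := by
  have hX2 : (0 : ℤ) ≤ (X : ℤ) ^ 2 := by positivity
  have hX3 : (0 : ℤ) ≤ (X : ℤ) ^ 3 := by positivity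
  have e6a : ((X : ℤ) ^ 2) ^ 3 = (X : ℤ) ^ 6 := by ring
  have e6b : ((X : ℤ) ^ 3) ^ 2 = (X : ℤ) ^ 6 := by ring
  constructor
  · intro h
    have hA : |AB.1| ^ 3 ≤ ((X : ℤ) ^ 2) ^ 3 := by
      rw [e6a]; exact le_trans (le_max_left _ _) h
    have hB : AB.2 ^ 2 ≤ ((X : ℤ) ^ 3) ^ 2 := by
      rw [e6b]; exact le_trans (le_max_right _ _) h
    exact ⟨(pow_le_pow_iff_left₀ (abs_nonneg _) hX2 (by norm_num)).mp hA,
      abs_le_of_sq_le_sq hB hX3⟩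
  · rintro ⟨hA, hB⟩
    have hA' : |AB.1| ^ 3 ≤ (X : ℤ) ^ 6 := by
      rw [← e6a]; exact (pow_le_pow_iff_left₀ (abs_nonneg _) hX2 (by norm_num)).mpr hA
    have hB' : AB.2 ^ 2 ≤ (X : ℤ) ^ 6 := by
      rw [← e6b, ← sq_abs AB.2]
      exact (pow_le_pow_iff_left₀ (abs_nonneg _) hX3 (by norm_num)).mpr hB
    exact max_le hA' hB'

/-- Membership in Duke's `𝒞(X)`: the enclosing box is redundant (Duke 1997, p. 815).
[cite: Duke1997, p. 815] -/
theorem mem_dukeFamily_iff (AB : ℤ × ℤ) (X : ℕ) :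
    AB ∈ dukeFamily X ↔ IsInHeightFamily AB ∧ dukeHeight AB ≤ (X : ℤ) ^ 6 := by
  simp only [dukeFamily, Finset.mem_filter, Finset.mem_product, Finset.mem_Icc,
    and_iff_right_iff_imp, and_imp]
  intro _ hH
  obtain ⟨hA, hB⟩ := (dukeHeight_le_iff AB X).mp hH
  exact ⟨abs_le.mp hA, abs_le.mp hB⟩

/-- `ℰ(X) ⊆ 𝒞(X)` (Duke 1997, p. 815). [cite: Duke1997, p. 815] -/
theorem dukeExceptionalFamily_subset (X : ℕ) : dukeExceptionalFamily X ⊆ dukeFamily X :=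
  Finset.filter_subset _ _

/-- Membership in `ℰ(X)` (Duke 1997, p. 815). [cite: Duke1997, p. 815] -/
theorem mem_dukeExceptionalFamily_iff (AB : ℤ × ℤ) (X : ℕ) :
    AB ∈ dukeExceptionalFamily X ↔
      AB ∈ dukeFamily X ∧ ∃ N : ℕ, IsExceptionalPrime (shortWeierstrass AB) N := by
  simp [dukeExceptionalFamily]

/-- The ratio `|ℰ(X)| / |𝒞(X)|` lies in `[0, 1]` (junk value `0` if `𝒞(X) = ∅`) (elementary).
[folklore] -/
theorem dukeExceptional_ratio_mem_Icc (X : ℕ) :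
    ((dukeExceptionalFamily X).card : ℝ) / (dukeFamily X).card ∈ Set.Icc (0 : ℝ) 1 := by
  refine ⟨div_nonneg (Nat.cast_nonneg _) (Nat.cast_nonneg _), div_le_one_of_le₀ ?_ (Nat.cast_nonneg _)⟩
  exact_mod_cast Finset.card_le_card (dukeExceptionalFamily_subset X)

/-- Box nesting, first half: Duke's box `H ≤ X⁶` sits inside the tree's Bhargava–Shankar box
`naiveHeight = max(4|r|³, 27 s²) < Y` as soon as `27·X⁶ < Y` (elementary; the transfer step named in
PERCENT-FULL §(ii).2 (F1)). [folklore] -/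
theorem dukeFamily_subset_heightFamilyBelow {X Y : ℕ} (hXY : 27 * X ^ 6 < Y) :
    dukeFamily X ⊆ heightFamilyBelow Y := by
  intro AB hAB
  rw [mem_dukeFamily_iff] at hAB
  obtain ⟨hfam, hH⟩ := hAB
  rw [mem_heightFamilyBelow_iff]
  refine ⟨hfam, ?_⟩
  have hXY' : (27 : ℤ) * (X : ℤ) ^ 6 < (Y : ℤ) := by exact_mod_cast hXY
  have hA : |AB.1| ^ 3 ≤ (X : ℤ) ^ 6 := le_trans (le_max_left _ _) hH
  have hB : AB.2 ^ 2 ≤ (X : ℤ) ^ 6 := le_trans (le_max_right _ _) hH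
  have h6 : (0 : ℤ) ≤ (X : ℤ) ^ 6 := by positivity
  unfold naiveHeight
  refine max_lt ?_ ?_ <;> linarith

/-- Box nesting, second half: the tree's box `naiveHeight < Y` sits inside Duke's box `H ≤ X⁶` as
soon as `Y ≤ X⁶` (elementary). [folklore] -/
theorem heightFamilyBelow_subset_dukeFamily {X Y : ℕ} (hYX : Y ≤ X ^ 6) :
    heightFamilyBelow Y ⊆ dukeFamily X := by
  intro AB hAB
  rw [mem_heightFamilyBelow_iff] at hAB
  obtain ⟨hfam, hH⟩ := hAB
  rw [mem_dukeFamily_iff]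
  refine ⟨hfam, ?_⟩
  have hYX' : (Y : ℤ) ≤ (X : ℤ) ^ 6 := by exact_mod_cast hYX
  have hA : 4 * |AB.1| ^ 3 < (Y : ℤ) := lt_of_le_of_lt (le_max_left _ _) hH
  have hB : 27 * AB.2 ^ 2 < (Y : ℤ) := lt_of_le_of_lt (le_max_right _ _) hH
  have hA0 : (0 : ℤ) ≤ |AB.1| ^ 3 := by positivity
  have hB0 : (0 : ℤ) ≤ AB.2 ^ 2 := by positivity
  unfold dukeHeight
  refine max_le ?_ ?_ <;> linarith

end Literature.NumberTheory.EllipticCurves
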